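import Summits.QuantumFields.YangMills.Theorems.FluctuationComparisonRegPrIntLS2BetaEmlMemberFluctuation
import HarnessLib

/-!
# S2β · `hFlat` road, brick (G10) of UV3-NODE §64.2 step (1) — «HYBRID ×4»: the logarithm of a word of FOUR exp-means (times a flux context `H`)
# equals the independent four-fold mean of the member-word logarithms up to (context size) × Σ_slots (mean member FLUCTUATION)

Cell `ym3-torus` (rung R3 = continuum `SU(2)` Yang–Mills on the three-torus — NOT d = 4, NOT infinite volume, NOT a mass gap, NOT Clay).
Width seat «width 8» `ym3-torus-px8` (gen 21), FREE px helper on crux `stmt-QuantumFields-20520`, count-neutral, DEFINITION-FREE.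

WHY.  By ✓`…PlaquetteWordLoopForm` the level-`t` plaquette word of the record's average is `E₁·E₂·E₃·E₄·H₀` with every `E_m` an exp-mean of LOOP logarithms and
`H₀` the straight holonomy — all flux-small.  Four applications of ✓`…EmlMemberFluctuation.norm_mlog_ctx_expMean_sub_mean_le_fluct` (slot `m` with context
`A` = the already-expanded members before it, `B` = the still-averaged slots after it times `H`) turn `log` of the word into the INDEPENDENT four-fold mean
`n⁻⁴Σ_{i,j,k,l} log(e^{a_i}e^{b_j}e^{c_k}e^{d_l}H)` — the input of ✓`…CouplingIdentity.mean_chain4_sub_mean_indep_eq` — at the cost `64·σ·Σ_m fluct_m`, `σ = 2(e^{4ρ} − 1)`.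
* §1 `hybrid_step` (uniform weights edition of ✓(iii-a♯) §3), `norm_prod_sub_one_le₂∕₃∕₄` (context sizes), `norm_mean_sub_mean_le` (means are 1-Lipschitz), `norm_mean_le`.
* §2 ★★ `norm_mlog_word4_sub_mean4_le` — the four-slot hybrid expansion.

HONEST SCOPE.  Bookkeeping over landed files; constants admissible, not optimal; nothing of Bałaban's analysis; the coupling (G5∕G6), the tent kernel (G7∕G8), the KEY LEMMA,
the recursion, `hFlat`, TUBE-REG∘, GAP♯∘, S2β, crux 20520 and `YM3TorusSU2` are NOT proved; no registered stub is closed; the Yang–Mills mass gap is NOT proved.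
References: T. Bałaban, CMP **109** (1987) [Balaban1987RG1] ((0.4)–(0.8) p.253); W. Rossmann, *Lie Groups* (OUP 2002) §1.3 [Rossmann2002].
-/

set_option autoImplicit false

noncomputable section

open NormedSpace Finset
open scoped BigOperators

namespace Summit.QuantumFields.YangMills.Theorems.FluctuationComparisonRegPrIntLS2BetaHybridFourSlot

open Literature.Analysis.Calculus.BCH (norm_mul_sub_one_le_of_le)
open Literature.Analysis.Calculus.ExpDifferential (norm_exp_sub_one_le_exp_norm_sub_one)
open Literature.MathematicalPhysics.QuantumFieldTheory.Balaban1983to89.MatrixLog (mlog)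
open Summit.QuantumFields.YangMills.Theorems.FluctuationComparisonRegPrIntLS2BetaEmlMemberFluctuation (norm_mlog_ctx_expMean_sub_mean_le_fluct)

variable {𝔸 : Type*} [NormedRing 𝔸] [NormedAlgebra ℂ 𝔸] [CompleteSpace 𝔸] [NormOneClass 𝔸]
variable {ι : Type*} [Fintype ι] [Nonempty ι]

/-! ## §1 One hybrid step with uniform weights; context sizes -/

/-- ✓(iii-a♯) §3 with uniform weights `|I|⁻¹`: `‖log(A·e^{ā}·B) − |I|⁻¹Σ_i log(A·e^{a_i}·B)‖ ≤ 64(‖A−1‖+‖B−1‖)·|I|⁻¹Σ_i‖a_i − ā‖`, `ā = |I|⁻¹Σ a`.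
[cite: Balaban1987RG1, (0.4)-(0.8) p.253] -/
theorem hybrid_step (a : ι → 𝔸) (ha : ∀ i, ‖a i‖ ≤ 1 / 20) {A B : 𝔸} (hA : ‖A - 1‖ ≤ 1 / 20) (hB : ‖B - 1‖ ≤ 1 / 20) :
    ‖mlog (A * exp (((Fintype.card ι : ℝ))⁻¹ • ∑ i, a i) * B) - ((Fintype.card ι : ℝ))⁻¹ • ∑ i, mlog (A * exp (a i) * B)‖ ≤
      64 * (‖A - 1‖ + ‖B - 1‖) * (((Fintype.card ι : ℝ))⁻¹ * ∑ i, ‖a i - ((Fintype.card ι : ℝ))⁻¹ • ∑ j, a j‖) := by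
  have hc : (0 : ℝ) < Fintype.card ι := Nat.cast_pos.mpr Fintype.card_pos
  have h := norm_mlog_ctx_expMean_sub_mean_le_fluct (𝔸 := 𝔸) Finset.univ (w := fun _ : ι => ((Fintype.card ι : ℝ))⁻¹)
    (fun _ _ => inv_nonneg.mpr hc.le) (by rw [Finset.sum_const, Finset.card_univ, nsmul_eq_mul, mul_inv_cancel₀ hc.ne'])
    (a := a) (fun i _ => ha i) hA hB
  simp only [← Finset.smul_sum] at h
  rw [← Finset.mul_sum] at h
  exact h

omit [NormedAlgebra ℂ 𝔸] [CompleteSpace 𝔸] [NormOneClass 𝔸] in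
/-- `‖x − 1‖ ≤ e^ρ − 1`, `‖y − 1‖ ≤ e^ρ − 1` ⟹ `‖xy − 1‖ ≤ e^{2ρ} − 1`. [folklore] -/
theorem norm_prod_sub_one_le₂ {x y : 𝔸} {ρ : ℝ} (hx : ‖x - 1‖ ≤ Real.exp ρ - 1) (hy : ‖y - 1‖ ≤ Real.exp ρ - 1) :
    ‖x * y - 1‖ ≤ Real.exp (2 * ρ) - 1 := by
  have h := norm_mul_sub_one_le_of_le hx hy; rwa [← two_mul] at h

omit [NormedAlgebra ℂ 𝔸] [CompleteSpace 𝔸] [NormOneClass 𝔸] in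
/-- Three factors: `‖xyz − 1‖ ≤ e^{3ρ} − 1`. [folklore] -/
theorem norm_prod_sub_one_le₃ {x y z : 𝔸} {ρ : ℝ} (hx : ‖x - 1‖ ≤ Real.exp ρ - 1) (hy : ‖y - 1‖ ≤ Real.exp ρ - 1)
    (hz : ‖z - 1‖ ≤ Real.exp ρ - 1) : ‖x * y * z - 1‖ ≤ Real.exp (3 * ρ) - 1 := by
  have h := norm_mul_sub_one_le_of_le (norm_prod_sub_one_le₂ hx hy) hz
  rwa [show 2 * ρ + ρ = 3 * ρ by ring] at h

omit [NormedAlgebra ℂ 𝔸] [CompleteSpace 𝔸] [NormOneClass 𝔸] in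
/-- Four factors: `‖xyzw − 1‖ ≤ e^{4ρ} − 1`. [folklore] -/
theorem norm_prod_sub_one_le₄ {x y z v : 𝔸} {ρ : ℝ} (hx : ‖x - 1‖ ≤ Real.exp ρ - 1) (hy : ‖y - 1‖ ≤ Real.exp ρ - 1)
    (hz : ‖z - 1‖ ≤ Real.exp ρ - 1) (hv : ‖v - 1‖ ≤ Real.exp ρ - 1) : ‖x * y * z * v - 1‖ ≤ Real.exp (4 * ρ) - 1 := by
  have h := norm_mul_sub_one_le_of_le (norm_prod_sub_one_le₃ hx hy hz) hv
  rwa [show 3 * ρ + ρ = 4 * ρ by ring] at h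

omit [NormOneClass 𝔸] in
/-- Numerics: `e^{1∕25} − 1 ≤ 1∕20`. [folklore] -/
theorem exp_one_div_25_sub_one_le : Real.exp (1 / 25) - 1 ≤ 1 / 20 := by
  have h := Real.exp_bound' (x := (1 / 25 : ℝ)) (by norm_num) (by norm_num) (n := 2) (by norm_num)
  simp only [Finset.sum_range_succ, Finset.sum_range_zero, Nat.factorial, Nat.cast_ofNat] at h
  norm_num at h
  linarith

omit [CompleteSpace 𝔸] [NormOneClass 𝔸] in
/-- Means are 1-Lipschitz: `‖|I|⁻¹Σ F − |I|⁻¹Σ G‖ ≤ |I|⁻¹Σ‖F i − G i‖`, and `≤ M` if every term is `≤ M`. [folklore] -/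
theorem norm_mean_sub_mean_le (F G : ι → 𝔸) {M : ℝ} (h : ∀ i, ‖F i - G i‖ ≤ M) :
    ‖((Fintype.card ι : ℝ))⁻¹ • ∑ i, F i - ((Fintype.card ι : ℝ))⁻¹ • ∑ i, G i‖ ≤ M := by
  have hc : (0 : ℝ) < Fintype.card ι := Nat.cast_pos.mpr Fintype.card_pos
  rw [← smul_sub, ← Finset.sum_sub_distrib, norm_smul, norm_inv, Real.norm_of_nonneg hc.le]
  calc ((Fintype.card ι : ℝ))⁻¹ * ‖∑ i, (F i - G i)‖ ≤ ((Fintype.card ι : ℝ))⁻¹ * ∑ _i : ι, M :=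
        mul_le_mul_of_nonneg_left ((norm_sum_le _ _).trans (Finset.sum_le_sum fun i _ => h i)) (inv_nonneg.mpr hc.le)
    _ = M := by rw [Finset.sum_const, Finset.card_univ, nsmul_eq_mul, inv_mul_cancel_left₀ hc.ne']

omit [CompleteSpace 𝔸] [NormOneClass 𝔸] in
/-- The norm of a uniform mean is at most the bound of its members. [folklore] -/
theorem norm_mean_le (a : ι → 𝔸) {ρ : ℝ} (ha : ∀ i, ‖a i‖ ≤ ρ) : ‖((Fintype.card ι : ℝ))⁻¹ • ∑ i, a i‖ ≤ ρ := by
  have h := norm_mean_sub_mean_le a (fun _ => (0 : 𝔸)) (M := ρ) (fun i => by simpa using ha i)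
  simpa using h

/-! ## §2 The four-slot hybrid expansion -/

/-- ★★ **HYBRID ×4**: member logarithms `a, b, c, d : ι → 𝔸` with `‖·‖ ≤ ρ`, a context `‖H − 1‖ ≤ e^ρ − 1`, `ρ ≤ 1∕100`, means `ā = |I|⁻¹Σa` etc., fluctuations
`fl(a) = |I|⁻¹Σ_i‖a_i − ā‖` etc.:
`‖log(e^{ā}e^{b̄}e^{c̄}e^{d̄}H) − |I|⁻⁴Σ_{i,j,k,l} log(e^{a_i}e^{b_j}e^{c_k}e^{d_l}H)‖ ≤ 64·2(e^{4ρ}−1)·(fl(a) + fl(b) + fl(c) + fl(d))` — (context size) × Σ (mean member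
FLUCTUATION); UV3-NODE §64.2 step (1). [cite: Balaban1987RG1, (0.4)-(0.8) p.253] -/
theorem norm_mlog_word4_sub_mean4_le (a b c d : ι → 𝔸) (H : 𝔸) {ρ : ℝ} (hρ : ρ ≤ 1 / 100)
    (ha : ∀ i, ‖a i‖ ≤ ρ) (hb : ∀ i, ‖b i‖ ≤ ρ) (hc : ∀ i, ‖c i‖ ≤ ρ) (hd : ∀ i, ‖d i‖ ≤ ρ) (hH : ‖H - 1‖ ≤ Real.exp ρ - 1) :
    ‖mlog (exp (((Fintype.card ι : ℝ))⁻¹ • ∑ i, a i) * exp (((Fintype.card ι : ℝ))⁻¹ • ∑ i, b i) *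
          exp (((Fintype.card ι : ℝ))⁻¹ • ∑ i, c i) * exp (((Fintype.card ι : ℝ))⁻¹ • ∑ i, d i) * H) -
        ((Fintype.card ι : ℝ))⁻¹ • ∑ i, ((Fintype.card ι : ℝ))⁻¹ • ∑ j, ((Fintype.card ι : ℝ))⁻¹ • ∑ k, ((Fintype.card ι : ℝ))⁻¹ • ∑ l,
          mlog (exp (a i) * exp (b j) * exp (c k) * exp (d l) * H)‖ ≤
      64 * (2 * (Real.exp (4 * ρ) - 1)) *
        ((((Fintype.card ι : ℝ))⁻¹ * ∑ i, ‖a i - ((Fintype.card ι : ℝ))⁻¹ • ∑ j, a j‖) +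
          (((Fintype.card ι : ℝ))⁻¹ * ∑ i, ‖b i - ((Fintype.card ι : ℝ))⁻¹ • ∑ j, b j‖) +
          (((Fintype.card ι : ℝ))⁻¹ * ∑ i, ‖c i - ((Fintype.card ι : ℝ))⁻¹ • ∑ j, c j‖) +
          (((Fintype.card ι : ℝ))⁻¹ * ∑ i, ‖d i - ((Fintype.card ι : ℝ))⁻¹ • ∑ j, d j‖)) := by
  -- abbreviations
  set n : ℝ := (Fintype.card ι : ℝ) with hn
  set abar := n⁻¹ • ∑ i, a i with habar
  set bbar := n⁻¹ • ∑ i, b i with hbbar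
  set cbar := n⁻¹ • ∑ i, c i with hcbar
  set dbar := n⁻¹ • ∑ i, d i with hdbar
  set fa := n⁻¹ * ∑ i, ‖a i - abar‖ with hfa
  set fb := n⁻¹ * ∑ i, ‖b i - bbar‖ with hfb
  set fc := n⁻¹ * ∑ i, ‖c i - cbar‖ with hfc
  set fd := n⁻¹ * ∑ i, ‖d i - dbar‖ with hfd
  set σ : ℝ := 2 * (Real.exp (4 * ρ) - 1) with hσ
  have hρ0 : 0 ≤ ρ := (norm_nonneg _).trans (ha (Classical.arbitrary ι))
  -- numerics: everything stays in the 1/20-ball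
  have h4ρ : Real.exp (4 * ρ) - 1 ≤ 1 / 20 :=
    le_trans (by gcongr; linarith) exp_one_div_25_sub_one_le
  have hmono : ∀ {k : ℝ}, k ≤ 4 → 0 ≤ k → Real.exp (k * ρ) - 1 ≤ Real.exp (4 * ρ) - 1 := fun {k} hk hk0 => by
    have hkρ : k * ρ ≤ 4 * ρ := by nlinarith
    gcongr
  have h1ρ : Real.exp ρ - 1 ≤ Real.exp (4 * ρ) - 1 := by simpa using hmono (k := 1) (by norm_num) (by norm_num)
  have hρ20 : ρ ≤ 1 / 20 := by linarith
  -- sizes of the single factors (`‖eˣ − 1‖ ≤ e^{‖x‖} − 1 ≤ e^ρ − 1`; the packaged form is ✓`NE7GradientCurrency.norm_exp_sub_one_le`, inlined here)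
  have hexp1 : ∀ {x : 𝔸}, ‖x‖ ≤ ρ → ‖exp x - 1‖ ≤ Real.exp ρ - 1 := fun {x} hx =>
    (norm_exp_sub_one_le_exp_norm_sub_one x).trans (by gcongr)
  have hea : ∀ i, ‖exp (a i) - 1‖ ≤ Real.exp ρ - 1 := fun i => hexp1 (ha i)
  have heb : ∀ i, ‖exp (b i) - 1‖ ≤ Real.exp ρ - 1 := fun i => hexp1 (hb i)
  have hec : ∀ i, ‖exp (c i) - 1‖ ≤ Real.exp ρ - 1 := fun i => hexp1 (hc i)
  have hab' : ‖abar‖ ≤ ρ := norm_mean_le a ha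
  have hbb' : ‖bbar‖ ≤ ρ := norm_mean_le b hb
  have hcb' : ‖cbar‖ ≤ ρ := norm_mean_le c hc
  have hdb' : ‖dbar‖ ≤ ρ := norm_mean_le d hd
  have hebb : ‖exp bbar - 1‖ ≤ Real.exp ρ - 1 := hexp1 hbb'
  have hecb : ‖exp cbar - 1‖ ≤ Real.exp ρ - 1 := hexp1 hcb'
  have hedb : ‖exp dbar - 1‖ ≤ Real.exp ρ - 1 := hexp1 hdb'
  have hfa0 : 0 ≤ fa := mul_nonneg (inv_nonneg.mpr (by positivity)) (Finset.sum_nonneg fun _ _ => norm_nonneg _)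
  have hfb0 : 0 ≤ fb := mul_nonneg (inv_nonneg.mpr (by positivity)) (Finset.sum_nonneg fun _ _ => norm_nonneg _)
  have hfc0 : 0 ≤ fc := mul_nonneg (inv_nonneg.mpr (by positivity)) (Finset.sum_nonneg fun _ _ => norm_nonneg _)
  have hfd0 : 0 ≤ fd := mul_nonneg (inv_nonneg.mpr (by positivity)) (Finset.sum_nonneg fun _ _ => norm_nonneg _)
  have hx4 : ∀ {x : ℝ}, x ≤ Real.exp (4 * ρ) - 1 → ∀ {y : ℝ}, y ≤ Real.exp (4 * ρ) - 1 → x + y ≤ σ := fun hx _ hy => by rw [hσ]; linarith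
  -- the contexts (right-associated words)
  have hB1 : ‖exp bbar * (exp cbar * (exp dbar * H)) - 1‖ ≤ Real.exp (4 * ρ) - 1 := by
    simpa only [mul_assoc] using norm_prod_sub_one_le₄ hebb hecb hedb hH
  have hB2 : ‖exp cbar * (exp dbar * H) - 1‖ ≤ Real.exp (4 * ρ) - 1 := by
    simpa only [mul_assoc] using (norm_prod_sub_one_le₃ hecb hedb hH).trans (hmono (by norm_num) (by norm_num))
  have hB3 : ‖exp dbar * H - 1‖ ≤ Real.exp (4 * ρ) - 1 := (norm_prod_sub_one_le₂ hedb hH).trans (hmono (by norm_num) (by norm_num))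
  have hB4 : ‖H - 1‖ ≤ Real.exp (4 * ρ) - 1 := hH.trans h1ρ
  have hA2 : ∀ i, ‖exp (a i) - 1‖ ≤ Real.exp (4 * ρ) - 1 := fun i => (hea i).trans h1ρ
  have hA3 : ∀ i j, ‖exp (a i) * exp (b j) - 1‖ ≤ Real.exp (4 * ρ) - 1 := fun i j =>
    (norm_prod_sub_one_le₂ (hea i) (heb j)).trans (hmono (by norm_num) (by norm_num))
  have hA4 : ∀ i j k, ‖exp (a i) * (exp (b j) * exp (c k)) - 1‖ ≤ Real.exp (4 * ρ) - 1 := fun i j k => by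
    simpa only [mul_assoc] using (norm_prod_sub_one_le₃ (hea i) (heb j) (hec k)).trans (hmono (by norm_num) (by norm_num))
  -- STEP 1: slot `a`, context `A = 1`, `B = e^{b̄}(e^{c̄}(e^{d̄}H))`
  have e1 : ‖mlog (exp abar * (exp bbar * (exp cbar * (exp dbar * H)))) -
      n⁻¹ • ∑ i, mlog (exp (a i) * (exp bbar * (exp cbar * (exp dbar * H))))‖ ≤ 64 * σ * fa := by
    have h := hybrid_step a (fun i => (ha i).trans hρ20) (A := (1 : 𝔸)) (B := exp bbar * (exp cbar * (exp dbar * H))) (by simp) (hB1.trans h4ρ)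
    simp only [one_mul, sub_self, norm_zero, zero_add] at h
    exact h.trans (mul_le_mul_of_nonneg_right (mul_le_mul_of_nonneg_left (by rw [hσ]; linarith [hB1, (norm_nonneg _ : 0 ≤ ‖exp bbar * (exp cbar * (exp dbar * H)) - 1‖)]) (by norm_num)) hfa0)
  -- STEP 2: for each `i`, slot `b`, context `A = e^{a_i}`, `B = e^{c̄}(e^{d̄}H)`
  have s2 : ∀ i, ‖mlog (exp (a i) * (exp bbar * (exp cbar * (exp dbar * H)))) -
      n⁻¹ • ∑ j, mlog (exp (a i) * (exp (b j) * (exp cbar * (exp dbar * H))))‖ ≤ 64 * σ * fb := fun i => by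
    have h := hybrid_step b (fun j => (hb j).trans hρ20) (A := exp (a i)) (B := exp cbar * (exp dbar * H)) ((hA2 i).trans h4ρ) (hB2.trans h4ρ)
    have h' := h.trans (mul_le_mul_of_nonneg_right (mul_le_mul_of_nonneg_left (hx4 (hA2 i) hB2) (by norm_num)) hfb0)
    simpa only [mul_assoc] using h'
  -- STEP 3: for each `i j`, slot `c`, context `A = e^{a_i}e^{b_j}`, `B = e^{d̄}H`
  have s3 : ∀ i j, ‖mlog (exp (a i) * (exp (b j) * (exp cbar * (exp dbar * H)))) -
      n⁻¹ • ∑ k, mlog (exp (a i) * (exp (b j) * (exp (c k) * (exp dbar * H))))‖ ≤ 64 * σ * fc := fun i j => by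
    have h := hybrid_step c (fun k => (hc k).trans hρ20) (A := exp (a i) * exp (b j)) (B := exp dbar * H) ((hA3 i j).trans h4ρ) (hB3.trans h4ρ)
    have h' := h.trans (mul_le_mul_of_nonneg_right (mul_le_mul_of_nonneg_left (hx4 (hA3 i j) hB3) (by norm_num)) hfc0)
    simpa only [mul_assoc] using h'
  -- STEP 4: for each `i j k`, slot `d`, context `A = e^{a_i}e^{b_j}e^{c_k}`, `B = H`
  have s4 : ∀ i j k, ‖mlog (exp (a i) * (exp (b j) * (exp (c k) * (exp dbar * H)))) -
      n⁻¹ • ∑ l, mlog (exp (a i) * (exp (b j) * (exp (c k) * (exp (d l) * H))))‖ ≤ 64 * σ * fd := fun i j k => by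
    have h := hybrid_step d (fun l => (hd l).trans hρ20) (A := exp (a i) * (exp (b j) * exp (c k))) (B := H) ((hA4 i j k).trans h4ρ) (hB4.trans h4ρ)
    have h' := h.trans (mul_le_mul_of_nonneg_right (mul_le_mul_of_nonneg_left (hx4 (hA4 i j k) hB4) (by norm_num)) hfd0)
    simpa only [mul_assoc] using h'
  -- right-associate the two words in the goal, name the nested means, chain the triangle inequality
  have eT0 : exp abar * exp bbar * exp cbar * exp dbar * H = exp abar * (exp bbar * (exp cbar * (exp dbar * H))) := by simp only [mul_assoc]
  have eM4 : ∀ i j k l, exp (a i) * exp (b j) * exp (c k) * exp (d l) * H = exp (a i) * (exp (b j) * (exp (c k) * (exp (d l) * H))) :=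
    fun i j k l => by simp only [mul_assoc]
  rw [eT0]; simp only [eM4]
  have d2 : ‖n⁻¹ • ∑ i, mlog (exp (a i) * (exp bbar * (exp cbar * (exp dbar * H)))) -
      n⁻¹ • ∑ i, n⁻¹ • ∑ j, mlog (exp (a i) * (exp (b j) * (exp cbar * (exp dbar * H))))‖ ≤ 64 * σ * fb :=
    norm_mean_sub_mean_le _ _ fun i => s2 i
  have d3 : ‖n⁻¹ • ∑ i, n⁻¹ • ∑ j, mlog (exp (a i) * (exp (b j) * (exp cbar * (exp dbar * H)))) -
      n⁻¹ • ∑ i, n⁻¹ • ∑ j, n⁻¹ • ∑ k, mlog (exp (a i) * (exp (b j) * (exp (c k) * (exp dbar * H))))‖ ≤ 64 * σ * fc :=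
    norm_mean_sub_mean_le _ _ fun i => norm_mean_sub_mean_le _ _ fun j => s3 i j
  have d4 : ‖n⁻¹ • ∑ i, n⁻¹ • ∑ j, n⁻¹ • ∑ k, mlog (exp (a i) * (exp (b j) * (exp (c k) * (exp dbar * H)))) -
      n⁻¹ • ∑ i, n⁻¹ • ∑ j, n⁻¹ • ∑ k, n⁻¹ • ∑ l, mlog (exp (a i) * (exp (b j) * (exp (c k) * (exp (d l) * H))))‖ ≤ 64 * σ * fd :=
    norm_mean_sub_mean_le _ _ fun i => norm_mean_sub_mean_le _ _ fun j => norm_mean_sub_mean_le _ _ fun k => s4 i j k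
  calc _ ≤ _ + _ := norm_sub_le_norm_sub_add_norm_sub _ (n⁻¹ • ∑ i, mlog (exp (a i) * (exp bbar * (exp cbar * (exp dbar * H))))) _
    _ ≤ 64 * σ * fa + (64 * σ * fb + (64 * σ * fc + 64 * σ * fd)) := by
        refine add_le_add e1 ((norm_sub_le_norm_sub_add_norm_sub _ _ _).trans (add_le_add d2 ?_))
        exact (norm_sub_le_norm_sub_add_norm_sub _ _ _).trans (add_le_add d3 d4)
    _ = 64 * σ * (fa + fb + fc + fd) := by ring

end Summit.QuantumFields.YangMills.Theorems.FluctuationComparisonRegPrIntLS2BetaHybridFourSlot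

end
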